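import Mathlib
import Summits.Ventures.HodgeRepro.Tier4.Common.RowPlane
import Summits.Ventures.HodgeRepro.Tier4.Line1.PlaneDefs
import Summits.Ventures.HodgeRepro.Tier4.Line1.RowPlaneGenuine

/-!
# Tier4/Line1/CMQuadData — the quadratic data of a CM field over its maximal real subfield, and the DEFINITE GENUINE
seesaw planes over `E⁺` (the (I0) input `k = E′⁺`, `pl` of `line1_realise`)

Blind re-derivation cell `pub-hodge-repro`, Tier 4 (README §9–§10), seat t4-L1-p3 (gen 2).  Target tree path
`lean/Summits/Ventures/HodgeRepro/Tier4/Line1/CMQuadData.lean`.  Imports `Common.RowPlane` (typer-2's `QuadData`,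
`PlaneData.ofLinesRow`), `Line1.PlaneDefs` (`IsDefinite`, `IsGenuineRow`) and `Line1.RowPlaneGenuine`
(`isGenuineRow_ofLinesRow`, `isDefinite_ofLinesRow`).  Mathlib: `NumberField.IsCMField` (`complexConj`,
`complexConj_eq_self_iff`, `complexEmbedding_complexConj`), `NumberField.ComplexEmbedding.lift`.

WHAT THIS IS.  LINE L1's costume `line1_realise` (Skeleton v0.31 L1226) takes `k = E′⁺ = maximalRealSubfield E`
(Mathlib) and the seesaw plane as a `PlaneData k` that is `IsDefinite` (at `w₀ = τ₀|_{E′⁺}`) and `IsGenuineRow` —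
the latter asks for the generator `ω` of `E′/k` with `Ω² = −n`, `−n` NOT a square in `k` (PlaneDefs v0.2).  This file
supplies, for EVERY CM field `E` (Mathlib's `IsCMField`): a purely imaginary element `ω ≠ 0` (`c(ω) = −ω`,
`exists_complexConj_eq_neg`), its norm parameter `δ = −ω² ∈ E⁺` (`cmDelta`), which is NOT a square in `E⁺`
(`cmDelta_not_isSquare`: `ω² = r²` with `r ∈ E⁺` would put `ω = ±r` in `E⁺`, fixed by `c`) and TOTALLY POSITIVE
(`cmDelta_pos`: at every real embedding `σ` of `E⁺`, lifted to `φ : E → ℂ`, `φ(ω)` is purely imaginary, so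
`σ(δ) = −φ(ω)² = (Im φ(ω))² > 0`); the trace-zero quadratic datum `cmQuad ω h = (0, δ)`; and the corollary
`isDefinite_isGenuineRow_ofLinesRow_cmQuad`: for line scalars `a, b ∈ E⁺ˣ` of the same sign at a real embedding `σ`,
typer-2's row plane `ofLinesRow (cmQuad ω h) a b 1` is `IsDefinite` and `IsGenuineRow` — the DEFINED input
`hdef ∧ hgen` of L1's `exists_rtfDatum_defined` on the CM field of the target.  WHICH `a, b` (and which transport of
the second torus) are the seesaw plane of Liu 2021 Lemma D.2(2) is part of the costume's identification (free half),
not decided here: this file covers every diagonal hermitian plane over `E′`.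
Nothing here says anything about the status of the Hodge conjecture for CM abelian varieties, which is NOT proved
(HC_CM is NOT proved by anyone in this repository).
-/

set_option autoImplicit false

noncomputable section

namespace Summit.Ventures.HodgeRepro.Tier4.Line1

open Common NumberField

section CMField

variable (E : Type) [Field E] [NumberField E] [IsCMField E]

/-- **A CM field has a non-zero purely imaginary element**: `c(ω) = −ω`, `ω ≠ 0` (take `ω = x − c(x)` for any `x`
not fixed by the complex conjugation `c`, which is not the identity). -/
theorem exists_complexConj_eq_neg : ∃ ω : E, ω ≠ 0 ∧ IsCMField.complexConj E ω = -ω := by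
  have hne := IsCMField.complexConj_ne_one E
  have : ∃ x : E, IsCMField.complexConj E x ≠ x := by
    by_contra h
    push Not at h
    exact hne (AlgEquiv.ext h)
  obtain ⟨x, hx⟩ := this
  refine ⟨x - IsCMField.complexConj E x, ?_, ?_⟩
  · intro h0
    exact hx (by rw [sub_eq_zero] at h0; exact h0.symm)
  · rw [map_sub, IsCMField.complexConj_apply_apply, neg_sub]

variable {E}

/-- The square of a purely imaginary element lies in the maximal real subfield. -/
theorem mul_self_mem_maximalRealSubfield {ω : E} (h : IsCMField.complexConj E ω = -ω) :
    ω * ω ∈ maximalRealSubfield E := by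
  rw [← IsCMField.complexConj_eq_self_iff, map_mul, h, neg_mul_neg]

/-- **The norm parameter `δ = −ω² = ω c(ω) ∈ E⁺`** of a purely imaginary `ω`. -/
def cmDelta (ω : E) (h : IsCMField.complexConj E ω = -ω) : maximalRealSubfield E :=
  ⟨-(ω * ω), neg_mem (mul_self_mem_maximalRealSubfield h)⟩

/-- `δ = −ω²` in `E`. -/
theorem coe_cmDelta (ω : E) (h : IsCMField.complexConj E ω = -ω) : ((cmDelta ω h : maximalRealSubfield E) : E) = -(ω * ω) :=
  rfl

/-- **`−δ = ω²` is not a square in `E⁺`**: `ω² = r²` with `r ∈ E⁺` forces `ω = ±r ∈ E⁺`, fixed by `c`, against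
`c(ω) = −ω ≠ ω`. -/
theorem cmDelta_not_isSquare (ω : E) (hω : ω ≠ 0) (h : IsCMField.complexConj E ω = -ω) :
    ¬ IsSquare (-(cmDelta ω h)) := by
  rintro ⟨r, hr⟩
  have hr' : ω * ω = (r : E) * (r : E) := by
    have := congrArg (fun x : maximalRealSubfield E => (x : E)) hr
    simpa [coe_cmDelta] using this
  have hmem : ω ∈ maximalRealSubfield E := by
    have h0 : (ω - r) * (ω + r) = 0 := by linear_combination hr'
    rcases mul_eq_zero.mp h0 with h1 | h1
    · rw [sub_eq_zero] at h1
      rw [h1]; exact r.2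
    · rw [add_eq_zero_iff_eq_neg] at h1
      rw [h1]; exact neg_mem r.2
  have hfix : IsCMField.complexConj E ω = ω := (IsCMField.complexConj_eq_self_iff E ω).mpr hmem
  rw [h] at hfix
  have : (2 : E) * ω = 0 := by linear_combination -hfix
  rcases mul_eq_zero.mp this with h2 | h2
  · exact two_ne_zero h2
  · exact hω h2

/-- **`δ` is totally positive**: at a real embedding `σ` of `E⁺`, lifted to a complex embedding `φ` of `E`, `φ(ω)` is
purely imaginary (`conj φ(ω) = φ(c ω) = −φ(ω)`), so `σ(δ) = −φ(ω)² = (Im φ(ω))² > 0`. -/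
theorem cmDelta_pos (ω : E) (hω : ω ≠ 0) (h : IsCMField.complexConj E ω = -ω)
    (σ : maximalRealSubfield E →+* ℝ) : 0 < σ (cmDelta ω h) := by
  let φ : E →+* ℂ := ComplexEmbedding.lift E (Complex.ofRealHom.comp σ)
  have hφ : ∀ x : maximalRealSubfield E, φ (x : E) = (σ x : ℂ) := fun x =>
    ComplexEmbedding.lift_algebraMap_apply E (Complex.ofRealHom.comp σ) x
  set z : ℂ := φ ω with hz
  have hconj : (starRingEnd ℂ) z = -z := by
    rw [hz, ← IsCMField.complexEmbedding_complexConj E φ ω, h, map_neg]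
  have hre : z.re = 0 := by
    have := congrArg Complex.re hconj
    simp only [Complex.conj_re, Complex.neg_re] at this
    linarith
  have hz0 : z ≠ 0 := fun h0 => hω (φ.injective (by rw [← hz, h0, map_zero]))
  have him : z.im ≠ 0 := by
    intro h0
    apply hz0
    exact Complex.ext hre h0
  have key : (σ (cmDelta ω h) : ℂ) = ((z.im * z.im : ℝ) : ℂ) := by
    rw [← hφ, coe_cmDelta, map_neg, map_mul, ← hz]
    apply Complex.ext
    · simp [hre, Complex.mul_re]
    · simp [hre, Complex.mul_im]
  have key' : σ (cmDelta ω h) = z.im * z.im := Complex.ofReal_injective key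
  rw [key']
  exact mul_self_pos.mpr him

/-- **The trace-zero quadratic datum of the CM field over `E⁺`**: `t = 0`, `n = δ = −ω²`. -/
def cmQuad (ω : E) (h : IsCMField.complexConj E ω = -ω) : QuadData (maximalRealSubfield E) :=
  ⟨0, cmDelta ω h⟩

/-- The datum has trace `0`. -/
theorem cmQuad_t (ω : E) (h : IsCMField.complexConj E ω = -ω) : (cmQuad ω h).t = 0 := rfl

/-- The datum has norm `δ`. -/
theorem cmQuad_n (ω : E) (h : IsCMField.complexConj E ω = -ω) : (cmQuad ω h).n = cmDelta ω h := rfl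

/-- **Every CM field has a trace-zero quadratic datum over `E⁺` with `−n` a non-square and `n` totally positive.** -/
theorem exists_cmQuad : ∃ q : QuadData (maximalRealSubfield E), q.t = 0 ∧ ¬ IsSquare (-q.n) ∧
    ∀ σ : maximalRealSubfield E →+* ℝ, 0 < σ q.n := by
  obtain ⟨ω, hω, h⟩ := exists_complexConj_eq_neg E
  exact ⟨cmQuad ω h, rfl, cmDelta_not_isSquare ω hω h, cmDelta_pos ω hω h⟩

/-- **The seesaw planes of the CM field are definite and genuine** (LINE L1's `IsDefinite ∧ IsGenuineRow`): for
line scalars `a, b ∈ E⁺` of the same sign at a real embedding `σ` of `E⁺`, typer-2's row plane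
`ofLinesRow (cmQuad ω h) a b 1 = ⟨a⟩ ⊕ ⟨b⟩` is definite at `σ` and genuine. -/
theorem isDefinite_isGenuineRow_ofLinesRow_cmQuad (ω : E) (hω : ω ≠ 0) (h : IsCMField.complexConj E ω = -ω)
    (a b : maximalRealSubfield E) (ha : a ≠ 0) (hb : b ≠ 0) (σ : maximalRealSubfield E →+* ℝ)
    (hpos : (0 < σ a ∧ 0 < σ b) ∨ (σ a < 0 ∧ σ b < 0)) :
    IsDefinite (PlaneData.ofLinesRow (cmQuad ω h) a b 1) ∧ IsGenuineRow (PlaneData.ofLinesRow (cmQuad ω h) a b 1) := by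
  refine ⟨isDefinite_ofLinesRow (cmQuad ω h) a b 1 rfl σ (cmDelta_pos ω hω h σ) ?_,
    isGenuineRow_ofLinesRow (cmQuad ω h) a b 1 ha hb one_ne_zero rfl (cmDelta_not_isSquare ω hω h)⟩
  simpa only [one_mul] using hpos

end CMField

end Summit.Ventures.HodgeRepro.Tier4.Line1

end
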